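import Mathlib.Analysis.Normed.Group.Tannery
import Mathlib.Analysis.Normed.Group.Ultra
import Mathlib.Analysis.SpecificLimits.Normed
import Literature.NumberTheory.EllipticCurves.PAdicHeights
import Literature.NumberTheory.EllipticCurves.ZpExtensionPadicUnitsProofs
import HarnessLib

/-!
# The Iwasawa `p`-adic logarithm: discharges for `PAdicHeights.lean` (proofs only)

`PAdicHeights.lean` defines the Iwasawa logarithm honestly, `Literature.NumberTheory.EllipticCurves.padicLog p x =
(p-1)⁻¹ · L((x · p^{-ord_p x})^{p-1})` with `L(y) = Literature.NumberTheory.EllipticCurves.padicLogSeries p y =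
∑' n, -((1-y)^{n+1})/(n+1)`, and states its four basic properties as NAMED FACTS (D-0014).  This
sibling file proves all four, with no new definitions:

* `hasSum_padicLog_holds : hasSum_padicLog p` — on principal units `log_p` is the sum of the
  logarithmic series (Iwasawa 1972, §4.4, Lemma);
* `padicLog_natCast_self_holds : padicLog_natCast_self p` — `log_p p = 0`;
* `padicLog_mul_holds : padicLog_mul p` — `log_p (xy) = log_p x + log_p y` on `ℚ_pˣ`;
* `padicLog_eq_zero_iff_holds : padicLog_eq_zero_iff p` — `ker log_p = p^ℤ · μ(ℚ_p)`:
  for `x ≠ 0`, `log_p x = 0 ↔ ∃ n k, k > 0 ∧ (x p^{-n})^k = 1`.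

The last one is the input `log_p q = 0 ⇒ q ∈ p^ℤ · μ ⇒ q algebraic` of the reduction of
`WeierstrassCurve.LInvariant_ne_zero` (non-vanishing of the Mazur–Tate–Teitelbaum `𝓛`-invariant)
to the Mahler–Manin theorem `Literature.NumberTheory.Transcendental.MahlerManinPadic`.

## Proof architecture (Iwasawa, *Lectures on p-adic L-functions*, §4.4; Washington §5.1)

All statements are over `ℚ_p` with its discrete absolute value, so "`‖t‖ < 1`" means
`‖t‖ ≤ p⁻¹` (`norm_le_inv_of_norm_lt_one`).
1. *Summability* (`summable_padicLogSeries_term`): `‖tⁿ/n‖_p ≤ n ‖t‖ⁿ` since `‖1/n‖_p =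
   p^{v_p(n)} ≤ n`.
2. *Limit formula* (`tendsto_pow_prime_pow_sub_one_div`): for a principal unit `y`,
   `(y^{p^k} - 1)/p^k → L(y)`: expand `y^{P} = (1 - t)^P` binomially; the `n`-th term
   `C(P-1, n)/(n+1) · (-t)^{n+1}` is dominated by `(n+1)‖t‖^{n+1}` uniformly in `k` and tends to
   `-t^{n+1}/(n+1)` because `C(p^k - 1, n) → (-1)^n` `p`-adically; Tannery's theorem
   (`tendsto_tsum_of_dominated_convergence`) exchanges limit and sum.
3. *Functional equation* (`padicLogSeries_mul`): `((y₁y₂)^P - 1)/P = (y₁^P-1)/P · y₂^P +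
   (y₂^P - 1)/P` and `y₂^P → 1`; hence also `L(y^k) = k L(y)` (`padicLogSeries_pow`).
4. *Isometry near `1`* (`norm_padicLogSeries_eq`): for `‖1 - y‖ < ‖2‖_p` every term of
   `L(y) + (1 - y) = -∑_{n ≥ 2} tⁿ/n` has norm `≤ ‖t‖² ‖1/2‖_p < ‖t‖` (the arithmetic input is
   `v_p(n) ≤ n - 2 + v_p(2)`, `padicValNat_add_two_le`), so `‖L(y)‖ = ‖1 - y‖` by the ultrametric
   inequality for `tsum` (`IsUltrametricDist.norm_tsum_le_of_forall_le_of_nonneg`); in particular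
   `L` is injective on `‖1 - y‖ < ‖2‖_p` (`eq_one_of_padicLogSeries_eq_zero`).
5. *Units*: `‖u‖ = 1 ⇒ ‖1 - u^{p-1}‖ < 1` (Fermat in the residue field, imported from
   `ZpExtensionPadicUnitsProofs`), and squares of principal units satisfy `‖1 - y²‖ < ‖2‖_p`
   (`norm_one_sub_sq_lt`), which is how the case `p = 2` (where `L(-1) = 0`) is absorbed:
   `L(y) = 0 ⇒ L(y²) = 0 ⇒ y² = 1`.
The kernel statement follows: (→) gives the root of unity `(x p^{-ord x})^{2(p-1)} = 1`;
(←) `(x p^{-n})^k = 1` forces `n = ord_p x` and `k · L(y) = L(y^k) = L(1) = 0`.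

## References

* [Iwasawa1972PadicL] K. Iwasawa, *Lectures on `p`-adic `L`-functions*, Ann. of Math. Stud. 74
  (1972), §4.4 (the logarithm `log_p`: series on principal units, `log_p p = 0`, homomorphism
  property, kernel `= p^ℤ · μ`).
* L. C. Washington, *Introduction to Cyclotomic Fields*, 2nd ed., GTM 83, §5.1, Prop. 5.4–5.6
  (same statements over `ℂ_p`).
* [MazurTateTeitelbaum1986Invent] §II.1 (the consumer: `𝓛_p(E) = log_p q / ord_p q`).
-/

noncomputable section

open Filter Topology IsUltrametricDist

namespace Literature.NumberTheory.EllipticCurves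

variable {p : ℕ} [Fact p.Prime]

/-! ### Norms of rational integers in `ℚ_p` -/

/-- `‖x⁻¹‖_p = p^{ord_p x}` for `x ≠ 0`. [folklore] -/
theorem norm_inv_eq_zpow_valuation {x : ℚ_[p]} (hx : x ≠ 0) :
    ‖x⁻¹‖ = (p : ℝ) ^ x.valuation := by
  rw [norm_inv, Padic.norm_eq_zpow_neg_valuation hx, zpow_neg, inv_inv]

/-- `‖1/m‖_p = p^{v_p(m)} ≤ m` for a positive integer `m`. [folklore] -/
theorem norm_inv_natCast_le {m : ℕ} (hm : m ≠ 0) : ‖((m : ℚ_[p]))⁻¹‖ ≤ m := by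
  have hm' : (m : ℚ_[p]) ≠ 0 := Nat.cast_ne_zero.mpr hm
  rw [norm_inv_eq_zpow_valuation hm', Padic.valuation_natCast, zpow_natCast]
  exact_mod_cast Nat.le_of_dvd (Nat.pos_of_ne_zero hm) pow_padicValNat_dvd

/-- `‖m‖_p ≤ 1` for a natural number `m`. [folklore] -/
theorem norm_natCast_le_one (m : ℕ) : ‖(m : ℚ_[p])‖ ≤ 1 := by
  simpa using Padic.norm_int_le_one (p := p) (m : ℤ)

/-- In `ℚ_p`, `‖t‖ < 1` forces `‖t‖ ≤ p⁻¹` (the value group is `p^ℤ`). [folklore] -/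
theorem norm_le_inv_of_norm_lt_one {t : ℚ_[p]} (ht : ‖t‖ < 1) : ‖t‖ ≤ (p : ℝ)⁻¹ := by
  have h := (Padic.norm_le_pow_iff_norm_lt_pow_add_one t (-1)).mpr (by simpa using ht)
  simpa using h

/-! ### The logarithmic series: general term, summability -/

/-- The general term `-(t^{n+1})/(n+1)` of `L(1 - t) = -∑ t^{n+1}/(n+1)` has norm
`≤ (n+1) ‖t‖^{n+1}`. [folklore] -/
theorem norm_padicLogSeries_term_le (t : ℚ_[p]) (n : ℕ) :
    ‖-(t ^ (n + 1)) / (n + 1 : ℚ_[p])‖ ≤ ((n + 1 : ℕ) : ℝ) * ‖t‖ ^ (n + 1) := by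
  rw [norm_div, norm_neg, norm_pow, div_eq_mul_inv, ← norm_inv, mul_comm]
  gcongr
  exact_mod_cast norm_inv_natCast_le (p := p) (Nat.succ_ne_zero n)

/-- Summability (in `ℝ`) of the dominating sequence `(n+1) r^{n+1}` for `0 ≤ r < 1`. [folklore] -/
theorem summable_succ_mul_pow {r : ℝ} (hr0 : 0 ≤ r) (hr : r < 1) :
    Summable fun n : ℕ ↦ ((n + 1 : ℕ) : ℝ) * r ^ (n + 1) := by
  have h := summable_pow_mul_geometric_of_norm_lt_one 1 (r := r) (by simpa [abs_of_nonneg hr0])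
  refine (h.comp_injective (add_left_injective 1)).congr fun n ↦ ?_
  simp [pow_one]

/-- The logarithmic series `∑ -(t^{n+1})/(n+1)` is summable in `ℚ_p` for `‖t‖ < 1`
(Iwasawa 1972, §4.4). [folklore] -/
theorem summable_padicLogSeries_term {t : ℚ_[p]} (ht : ‖t‖ < 1) :
    Summable fun n : ℕ ↦ -(t ^ (n + 1)) / (n + 1 : ℚ_[p]) :=
  Summable.of_norm_bounded (summable_succ_mul_pow (norm_nonneg t) ht)
    (norm_padicLogSeries_term_le t)

/-- `L(y) = ∑ -((1-y)^{n+1})/(n+1)` as a convergent sum, for `‖1 - y‖ < 1`. [folklore] -/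
theorem hasSum_padicLogSeries {y : ℚ_[p]} (hy : ‖1 - y‖ < 1) :
    HasSum (fun n : ℕ ↦ -((1 - y) ^ (n + 1)) / (n + 1 : ℚ_[p])) (padicLogSeries p y) :=
  (summable_padicLogSeries_term hy).hasSum

/-- `L(1) = 0`. [folklore] -/
@[simp]
theorem padicLogSeries_one : padicLogSeries p 1 = 0 := by
  simp [padicLogSeries]

/-! ### The limit formula `L(y) = lim_k (y^{p^k} - 1)/p^k` -/

/-- `(p^k : ℚ_p) → 0`. [folklore] -/
theorem tendsto_natCast_prime_pow_zero :
    Tendsto (fun k : ℕ ↦ ((p : ℚ_[p]) ^ k)) atTop (𝓝 0) :=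
  tendsto_pow_atTop_nhds_zero_of_norm_lt_one Padic.norm_p_lt_one

/-- `C(p^k - 1, n) → (-1)^n` in `ℚ_p` as `k → ∞` (`p^k → 0` `p`-adically and
`C(P - 1, n) = ∏_{j ≤ n} (P - j)/j`). [folklore] -/
theorem tendsto_choose_prime_pow_sub_one (n : ℕ) :
    Tendsto (fun k : ℕ ↦ ((Nat.choose (p ^ k - 1) n : ℕ) : ℚ_[p])) atTop (𝓝 ((-1) ^ n)) := by
  induction n with
  | zero => simp
  | succ n ih =>
    have hn1 : (n + 1 : ℚ_[p]) ≠ 0 := Nat.cast_add_one_ne_zero n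
    -- eventually `p^k > n + 1`, where the recursion `C(P-1,n+1)(n+1) = C(P-1,n)(P-1-n)` is exact
    have hev : ∀ᶠ k : ℕ in atTop, ((Nat.choose (p ^ k - 1) (n + 1) : ℕ) : ℚ_[p]) =
        ((Nat.choose (p ^ k - 1) n : ℕ) : ℚ_[p]) * (((p : ℚ_[p]) ^ k - 1 - n) / (n + 1)) := by
      filter_upwards [eventually_ge_atTop (n + 2)] with k hk
      have hP : n + 2 ≤ p ^ k := hk.trans (Nat.lt_pow_self (Fact.out : p.Prime).one_lt).le
      have h := Nat.choose_succ_right_eq (p ^ k - 1) n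
      have hcast : (((p ^ k - 1 - n : ℕ) : ℚ_[p])) = (p : ℚ_[p]) ^ k - 1 - n := by
        rw [Nat.cast_sub (by omega), Nat.cast_sub (by omega)]
        push_cast
        ring
      rw [mul_div_assoc', eq_div_iff hn1, ← hcast]
      exact_mod_cast h
    refine (Filter.tendsto_congr' hev).mpr ?_
    have hlim : Tendsto (fun k : ℕ ↦ ((p : ℚ_[p]) ^ k - 1 - n) / (n + 1)) atTop
        (𝓝 ((0 - 1 - n) / (n + 1))) :=
      ((tendsto_natCast_prime_pow_zero.sub_const 1).sub_const _).div_const _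
    have := ih.mul hlim
    convert this using 2
    field_simp
    ring

/-- For `P = p^k` and any `t`, the finite binomial sum
`∑_{n < P} C(P-1, n)/(n+1) · (-t)^{n+1} · ... ` : precisely,
`HasSum (n ↦ C(p^k - 1, n) / (n+1) · (-t)^{n+1}) (((1 - t)^{p^k} - 1) / p^k)`
(the general term vanishes for `n ≥ p^k`; binomial theorem and
`P · C(P-1, n) = (n+1) · C(P, n+1)`). [folklore] -/
theorem hasSum_choose_div_mul_pow (t : ℚ_[p]) (k : ℕ) :
    HasSum (fun n : ℕ ↦ ((Nat.choose (p ^ k - 1) n : ℕ) : ℚ_[p]) / (n + 1) * (-t) ^ (n + 1))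
      (((1 - t) ^ (p ^ k) - 1) / (p : ℚ_[p]) ^ k) := by
  set P : ℕ := p ^ k with hPdef
  have hP0 : P ≠ 0 := pow_ne_zero k (Fact.out : p.Prime).ne_zero
  have hPpos : 0 < P := Nat.pos_of_ne_zero hP0
  have hPc : ((P : ℕ) : ℚ_[p]) ≠ 0 := Nat.cast_ne_zero.mpr hP0
  have hPc' : (p : ℚ_[p]) ^ k = (P : ℚ_[p]) := by simp [hPdef]
  -- the general term vanishes for `n ≥ P`
  have hzero : ∀ n ∉ Finset.range P,
      ((Nat.choose (P - 1) n : ℕ) : ℚ_[p]) / (n + 1) * (-t) ^ (n + 1) = 0 := by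
    intro n hn
    rw [Finset.mem_range, not_lt] at hn
    rw [Nat.choose_eq_zero_of_lt (by omega)]
    simp
  have h : HasSum (fun n : ℕ ↦ ((Nat.choose (P - 1) n : ℕ) : ℚ_[p]) / (n + 1) * (-t) ^ (n + 1))
      (∑ n ∈ Finset.range P, ((Nat.choose (P - 1) n : ℕ) : ℚ_[p]) / (n + 1) * (-t) ^ (n + 1)) :=
    hasSum_sum_of_ne_finset_zero hzero
  rw [hPc']
  convert h using 1
  -- the finite identity: `∑_{n<P} C(P-1,n)/(n+1) (-t)^(n+1) = ((1-t)^P - 1)/P`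
  rw [div_eq_iff hPc, Finset.sum_mul]
  have hterm : ∀ n ∈ Finset.range P,
      ((Nat.choose (P - 1) n : ℕ) : ℚ_[p]) / (n + 1) * (-t) ^ (n + 1) * P =
        ((Nat.choose P (n + 1) : ℕ) : ℚ_[p]) * (-t) ^ (n + 1) := by
    intro n _
    have hid : P * Nat.choose (P - 1) n = Nat.choose P (n + 1) * (n + 1) := by
      have := Nat.add_one_mul_choose_eq (P - 1) n
      rwa [Nat.sub_add_cancel hPpos] at this
    have hid' : (P : ℚ_[p]) * ((Nat.choose (P - 1) n : ℕ) : ℚ_[p]) =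
        ((Nat.choose P (n + 1) : ℕ) : ℚ_[p]) * (n + 1) := by exact_mod_cast hid
    have hn1 : (n + 1 : ℚ_[p]) ≠ 0 := Nat.cast_add_one_ne_zero n
    field_simp
    linear_combination (-t) ^ (n + 1) * hid'
  rw [Finset.sum_congr rfl hterm]
  -- binomial theorem
  have hbin := add_pow (-t) 1 P
  simp only [one_pow, mul_one] at hbin
  rw [Finset.sum_range_succ'] at hbin
  simp only [pow_zero, Nat.choose_zero_right, Nat.cast_one, mul_one] at hbin
  rw [show (1 : ℚ_[p]) - t = -t + 1 by ring, hbin]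
  ring

/-- **Limit formula for the logarithmic series**: for `‖1 - y‖_p < 1`,
`(y^{p^k} - 1)/p^k → L(y)` as `k → ∞` (termwise limit of the binomial expansion, justified by
Tannery's theorem with the dominating sequence `(n+1)‖1-y‖^{n+1}`).  This is the classical
description of `log_p` on principal units. [folklore] -/
theorem tendsto_pow_prime_pow_sub_one_div (y : ℚ_[p]) (hy : ‖1 - y‖ < 1) :
    Tendsto (fun k : ℕ ↦ (y ^ (p ^ k) - 1) / (p : ℚ_[p]) ^ k) atTop
      (𝓝 (padicLogSeries p y)) := by
  set t : ℚ_[p] := 1 - y with ht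
  have hyt : y = 1 - t := by rw [ht]; ring
  -- the double family and its termwise limits
  set f : ℕ → ℕ → ℚ_[p] := fun k n ↦
    ((Nat.choose (p ^ k - 1) n : ℕ) : ℚ_[p]) / (n + 1) * (-t) ^ (n + 1) with hf
  have hab : ∀ n : ℕ, Tendsto (fun k ↦ f k n) atTop (𝓝 (-(t ^ (n + 1)) / (n + 1 : ℚ_[p]))) := by
    intro n
    have h := ((tendsto_choose_prime_pow_sub_one (p := p) n).div_const (n + 1 : ℚ_[p])).mul_const
      ((-t) ^ (n + 1))
    convert h using 2
    have hsq : (-1 : ℚ_[p]) ^ n * (-1) ^ n = 1 := by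
      rw [← mul_pow, neg_mul_neg, one_mul, one_pow]
    calc -(t ^ (n + 1)) / (n + 1 : ℚ_[p])
        = -((-1 : ℚ_[p]) ^ n * (-1) ^ n * t ^ (n + 1)) / (n + 1) := by rw [hsq, one_mul]
      _ = (-1) ^ n / (n + 1) * ((-1) ^ n * (-1) * t ^ (n + 1)) := by ring
      _ = (-1) ^ n / (n + 1 : ℚ_[p]) * (-t) ^ (n + 1) := by rw [neg_pow t, pow_succ (-1 : ℚ_[p]) n]
  have h_bound : ∀ᶠ k : ℕ in atTop, ∀ n, ‖f k n‖ ≤ ((n + 1 : ℕ) : ℝ) * ‖t‖ ^ (n + 1) := by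
    refine Eventually.of_forall fun k n ↦ ?_
    simp only [hf, norm_mul, norm_div, norm_pow, norm_neg]
    have h1 : ‖((Nat.choose (p ^ k - 1) n : ℕ) : ℚ_[p])‖ ≤ 1 := norm_natCast_le_one _
    have h2 : ‖(n + 1 : ℚ_[p])‖⁻¹ ≤ (n + 1 : ℕ) := by
      rw [← norm_inv]
      exact_mod_cast norm_inv_natCast_le (p := p) (Nat.succ_ne_zero n)
    calc ‖((Nat.choose (p ^ k - 1) n : ℕ) : ℚ_[p])‖ / ‖(n + 1 : ℚ_[p])‖ * ‖t‖ ^ (n + 1)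
        ≤ 1 * (n + 1 : ℕ) * ‖t‖ ^ (n + 1) := by
          rw [div_eq_mul_inv]
          gcongr
      _ = ((n + 1 : ℕ) : ℝ) * ‖t‖ ^ (n + 1) := by rw [one_mul]
  have hT := tendsto_tsum_of_dominated_convergence (summable_succ_mul_pow (norm_nonneg t)
    (by simpa [ht] using hy)) hab h_bound
  have hlim : ∑' n : ℕ, -(t ^ (n + 1)) / (n + 1 : ℚ_[p]) = padicLogSeries p y := by
    rw [padicLogSeries, ht]
  rw [hlim] at hT
  refine hT.congr fun k ↦ ?_
  change ∑' n, f k n = _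
  rw [(hasSum_choose_div_mul_pow t k).tsum_eq, hyt]


/-! ### Principal units and the functional equation -/

/-- `‖1 - y‖ < 1 ⇒ ‖y‖ = 1`. [folklore] -/
theorem norm_eq_one_of_norm_one_sub_lt {y : ℚ_[p]} (hy : ‖1 - y‖ < 1) : ‖y‖ = 1 := by
  have h : ‖y - 1‖ < ‖(1 : ℚ_[p])‖ := by rwa [norm_sub_rev, norm_one]
  simpa using Padic.norm_eq_of_norm_sub_lt_right h

/-- Principal units are closed under multiplication. [folklore] -/
theorem norm_one_sub_mul_lt {y₁ y₂ : ℚ_[p]} (h₁ : ‖1 - y₁‖ < 1) (h₂ : ‖1 - y₂‖ < 1) :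
    ‖1 - y₁ * y₂‖ < 1 := by
  have : 1 - y₁ * y₂ = (1 - y₁) + y₁ * (1 - y₂) := by ring
  rw [this]
  refine (norm_add_le_max _ _).trans_lt (max_lt h₁ ?_)
  rw [norm_mul, norm_eq_one_of_norm_one_sub_lt h₁, one_mul]
  exact h₂

/-- Principal units are closed under powers. [folklore] -/
theorem norm_one_sub_pow_lt {y : ℚ_[p]} (h : ‖1 - y‖ < 1) (k : ℕ) : ‖1 - y ^ k‖ < 1 := by
  induction k with
  | zero => simp
  | succ k ih =>
    rw [pow_succ]
    exact norm_one_sub_mul_lt ih h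

/-- **Functional equation of the logarithmic series on principal units**:
`L(y₁ y₂) = L(y₁) + L(y₂)` for `‖1 - yᵢ‖_p < 1` (Iwasawa 1972, §4.4).  Proof from the limit
formula: `((y₁y₂)^P - 1)/P = (y₁^P - 1)/P · y₂^P + (y₂^P - 1)/P` with `y₂^P → 1` (`P = p^k`).
[cite: Iwasawa1972PadicL, §4.4] -/
theorem padicLogSeries_mul {y₁ y₂ : ℚ_[p]} (h₁ : ‖1 - y₁‖ < 1) (h₂ : ‖1 - y₂‖ < 1) :
    padicLogSeries p (y₁ * y₂) = padicLogSeries p y₁ + padicLogSeries p y₂ := by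
  have hA := tendsto_pow_prime_pow_sub_one_div y₁ h₁
  have hB := tendsto_pow_prime_pow_sub_one_div y₂ h₂
  have hC := tendsto_pow_prime_pow_sub_one_div (y₁ * y₂) (norm_one_sub_mul_lt h₁ h₂)
  have hP0 : ∀ k : ℕ, (p : ℚ_[p]) ^ k ≠ 0 := fun k ↦
    pow_ne_zero k (Nat.cast_ne_zero.mpr (Fact.out : p.Prime).ne_zero)
  -- `y₂^{p^k} → 1`
  have hy2 : Tendsto (fun k : ℕ ↦ y₂ ^ (p ^ k)) atTop (𝓝 1) := by
    have h := (hB.mul (tendsto_natCast_prime_pow_zero (p := p))).add_const 1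
    rw [mul_zero, zero_add] at h
    refine h.congr fun k ↦ ?_
    rw [div_mul_cancel₀ _ (hP0 k), sub_add_cancel]
  have hsum := (hA.mul hy2).add hB
  rw [mul_one] at hsum
  refine tendsto_nhds_unique hC (hsum.congr fun k ↦ ?_)
  have := hP0 k
  rw [mul_pow]
  field_simp
  ring

/-- `L(y^k) = k · L(y)` on principal units. [folklore] -/
theorem padicLogSeries_pow {y : ℚ_[p]} (h : ‖1 - y‖ < 1) (k : ℕ) :
    padicLogSeries p (y ^ k) = k * padicLogSeries p y := by
  induction k with
  | zero => simp
  | succ k ih =>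
    rw [pow_succ, padicLogSeries_mul (norm_one_sub_pow_lt h k) h, ih]
    push_cast
    ring

/-! ### Injectivity of the logarithmic series near `1` -/

/-- Auxiliary: `v + 2 ≤ 3^v` for `v ≥ 1`. [folklore] -/
theorem add_two_le_three_pow {v : ℕ} (hv : 1 ≤ v) : v + 2 ≤ 3 ^ v := by
  induction v, hv using Nat.le_induction with
  | base => norm_num
  | succ v _ ih => rw [pow_succ]; omega

/-- Arithmetic input of the term estimate: `v_p(m) + 2 ≤ m + v_p(2)` for `m ≥ 2`
(i.e. `v_p(m) ≤ m - 2` for odd `p`, `v_2(m) ≤ m - 1`). [folklore] -/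
theorem padicValNat_add_two_le {m : ℕ} (hm : 2 ≤ m) :
    padicValNat p m + 2 ≤ m + padicValNat p 2 := by
  have hp : p.Prime := Fact.out
  have hle : p ^ padicValNat p m ≤ m := Nat.le_of_dvd (by omega) pow_padicValNat_dvd
  by_cases hp2 : p = 2
  · subst hp2
    have h1 : padicValNat 2 2 = 1 := padicValNat_self
    have h2 : padicValNat 2 m < 2 ^ padicValNat 2 m := Nat.lt_two_pow_self
    omega
  · have h3 : 3 ≤ p := by
      rcases hp.eq_two_or_odd' with h | h
      · exact absurd h hp2
      · have := hp.two_le; omega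
    have hv2 : padicValNat p 2 = 0 := by
      refine padicValNat.eq_zero_of_not_dvd fun h ↦ hp2 ?_
      exact (Nat.prime_dvd_prime_iff_eq hp Nat.prime_two).mp h
    rw [hv2, add_zero]
    rcases Nat.eq_zero_or_pos (padicValNat p m) with h0 | hpos
    · omega
    · have h4 : 3 ^ padicValNat p m ≤ p ^ padicValNat p m := Nat.pow_le_pow_left h3 _
      have h5 := add_two_le_three_pow hpos
      omega

/-- `‖2‖_p ≥ p⁻¹` (indeed `‖1/2‖_p ≤ 2 ≤ p`). [folklore] -/
theorem inv_le_norm_two : (p : ℝ)⁻¹ ≤ ‖(2 : ℚ_[p])‖ := by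
  have hp : p.Prime := Fact.out
  have h2 : ‖(2 : ℚ_[p])⁻¹‖ ≤ 2 := by exact_mod_cast norm_inv_natCast_le (p := p) two_ne_zero
  have h2p : ‖(2 : ℚ_[p])⁻¹‖ ≤ p := h2.trans (by exact_mod_cast hp.two_le)
  have hpos : 0 < ‖(2 : ℚ_[p])‖ := norm_pos_iff.mpr two_ne_zero
  rw [norm_inv] at h2p
  rw [inv_le_comm₀ (by exact_mod_cast hp.pos) hpos]
  exact h2p

/-- Term estimate: for `‖t‖_p < 1` and `m ≥ 2`, `‖t^m / m‖_p ≤ ‖t‖² · ‖1/2‖_p`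
(uses `‖t‖ ≤ p⁻¹` and `v_p(m) ≤ m - 2 + v_p(2)`). [folklore] -/
theorem norm_pow_div_natCast_le {t : ℚ_[p]} (ht : ‖t‖ < 1) {m : ℕ} (hm : 2 ≤ m) :
    ‖t ^ m / (m : ℚ_[p])‖ ≤ ‖t‖ ^ 2 * ‖(2 : ℚ_[p])⁻¹‖ := by
  have hp : p.Prime := Fact.out
  have hp1 : (1 : ℝ) ≤ p := by exact_mod_cast hp.one_lt.le
  have hp0 : (0 : ℝ) < p := by positivity
  have hm0 : (m : ℚ_[p]) ≠ 0 := by exact_mod_cast (show m ≠ 0 by omega)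
  have h2 : ‖(2 : ℚ_[p])⁻¹‖ = (p : ℝ) ^ padicValNat p 2 := by
    rw [norm_inv_eq_zpow_valuation two_ne_zero,
      show (2 : ℚ_[p]) = ((2 : ℕ) : ℚ_[p]) by norm_num, Padic.valuation_natCast, zpow_natCast]
  rw [norm_div, norm_pow, div_eq_mul_inv, ← norm_inv, norm_inv_eq_zpow_valuation hm0,
    Padic.valuation_natCast, zpow_natCast, h2]
  obtain ⟨j, rfl⟩ : ∃ j, m = j + 2 := ⟨m - 2, by omega⟩
  have hv : padicValNat p (j + 2) ≤ j + padicValNat p 2 := by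
    have := padicValNat_add_two_le (p := p) (m := j + 2) (by omega)
    omega
  calc ‖t‖ ^ (j + 2) * (p : ℝ) ^ padicValNat p (j + 2)
      = ‖t‖ ^ 2 * (‖t‖ ^ j * (p : ℝ) ^ padicValNat p (j + 2)) := by ring
    _ ≤ ‖t‖ ^ 2 * (((p : ℝ)⁻¹) ^ j * (p : ℝ) ^ padicValNat p (j + 2)) := by
        gcongr
        exact norm_le_inv_of_norm_lt_one ht
    _ ≤ ‖t‖ ^ 2 * (p : ℝ) ^ padicValNat p 2 := by
        gcongr
        rw [inv_pow, inv_mul_le_iff₀ (by positivity), ← pow_add]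
        exact pow_le_pow_right₀ hp1 hv

/-- **Tail estimate**: `‖L(y) + (1 - y)‖_p ≤ ‖1 - y‖² · ‖1/2‖_p` for `‖1 - y‖_p < 1`
(`L(y) = -t - t²/2 - t³/3 - ⋯`, `t = 1 - y`, every later term bounded by
`norm_pow_div_natCast_le`, and the ultrametric inequality for `tsum`). [folklore] -/
theorem norm_padicLogSeries_add_le {y : ℚ_[p]} (hy : ‖1 - y‖ < 1) :
    ‖padicLogSeries p y + (1 - y)‖ ≤ ‖1 - y‖ ^ 2 * ‖(2 : ℚ_[p])⁻¹‖ := by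
  have hsum := summable_padicLogSeries_term (p := p) hy
  -- split off the first term `-(1 - y)` of the series
  have h0 : padicLogSeries p y + (1 - y) =
      ∑' n : ℕ, -((1 - y) ^ (n + 1 + 1)) / (((n + 1 : ℕ) : ℚ_[p]) + 1) := by
    rw [padicLogSeries, hsum.tsum_eq_zero_add]
    simp only [zero_add, pow_one, Nat.cast_zero, div_one]
    ring
  rw [h0]
  refine norm_tsum_le_of_forall_le_of_nonneg (by positivity) fun n ↦ ?_
  have h := norm_pow_div_natCast_le hy (m := n + 2) (by omega)
  have he : (1 - y) ^ (n + 1 + 1) / (((n + 1 : ℕ) : ℚ_[p]) + 1) =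
      (1 - y) ^ (n + 2) / ((n + 2 : ℕ) : ℚ_[p]) := by
    push_cast
    ring
  rw [neg_div, norm_neg, he]
  exact h

/-- **Isometry of the logarithm near `1`**: for `‖1 - y‖_p < ‖2‖_p` (i.e. `y ∈ 1 + pℤ_p` for odd
`p`, `y ∈ 1 + 4ℤ₂` for `p = 2`) one has `‖L(y)‖_p = ‖1 - y‖_p` (Iwasawa 1972, §4.4).
[cite: Iwasawa1972PadicL, §4.4] -/
theorem norm_padicLogSeries_eq {y : ℚ_[p]} (hy : ‖1 - y‖ < ‖(2 : ℚ_[p])‖) :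
    ‖padicLogSeries p y‖ = ‖1 - y‖ := by
  have h2le : ‖(2 : ℚ_[p])‖ ≤ 1 := by simpa using norm_natCast_le_one (p := p) 2
  have hy1 : ‖1 - y‖ < 1 := hy.trans_le h2le
  by_cases ht0 : 1 - y = 0
  · have : y = 1 := (sub_eq_zero.mp ht0).symm
    simp [this]
  have h20 : (2 : ℚ_[p]) ≠ 0 := two_ne_zero
  have hlt : ‖padicLogSeries p y + (1 - y)‖ < ‖1 - y‖ := by
    refine (norm_padicLogSeries_add_le hy1).trans_lt ?_
    rw [norm_inv, pow_two, mul_assoc, ← div_eq_mul_inv]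
    refine mul_lt_of_lt_one_right (norm_pos_iff.mpr ht0) ?_
    rwa [div_lt_one (norm_pos_iff.mpr h20)]
  exact Padic.norm_eq_of_norm_add_lt_right hlt

/-- **Injectivity of the logarithm near `1`**: for `‖1 - y‖_p < ‖2‖_p`, `L(y) = 0 ⇒ y = 1`.
[cite: Iwasawa1972PadicL, §4.4] -/
theorem eq_one_of_padicLogSeries_eq_zero {y : ℚ_[p]} (hy : ‖1 - y‖ < ‖(2 : ℚ_[p])‖)
    (h : padicLogSeries p y = 0) : y = 1 := by
  have := norm_padicLogSeries_eq hy
  rw [h, norm_zero, eq_comm, norm_eq_zero, sub_eq_zero] at this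
  exact this.symm

/-- Squares of principal units land in the injectivity domain:
`‖1 - y‖_p < 1 ⇒ ‖1 - y²‖_p < ‖2‖_p` (`1 - y² = (1-y)(2-(1-y))`, `‖1-y‖ ≤ p⁻¹ ≤ ‖2‖`). [folklore] -/
theorem norm_one_sub_sq_lt {y : ℚ_[p]} (hy : ‖1 - y‖ < 1) :
    ‖1 - y ^ 2‖ < ‖(2 : ℚ_[p])‖ := by
  set t := 1 - y with ht
  have hfac : 1 - y ^ 2 = t * (2 + -t) := by rw [ht]; ring
  have h2pos : 0 < ‖(2 : ℚ_[p])‖ := norm_pos_iff.mpr two_ne_zero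
  rw [hfac, norm_mul]
  refine (mul_le_mul_of_nonneg_left (norm_add_le_max _ _) (norm_nonneg t)).trans_lt ?_
  rw [norm_neg, mul_max_of_nonneg _ _ (norm_nonneg t)]
  refine max_lt ?_ ?_
  · exact mul_lt_of_lt_one_left h2pos hy
  · have hp : p.Prime := Fact.out
    have htp : ‖t‖ ≤ (p : ℝ)⁻¹ := norm_le_inv_of_norm_lt_one hy
    have hp2 : (p : ℝ)⁻¹ ≤ ‖(2 : ℚ_[p])‖ := inv_le_norm_two
    have hp0 : (0 : ℝ) < (p : ℝ)⁻¹ := inv_pos.mpr (by exact_mod_cast hp.pos)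
    calc ‖t‖ * ‖t‖ ≤ ‖t‖ * (p : ℝ)⁻¹ := by gcongr
      _ < 1 * (p : ℝ)⁻¹ := mul_lt_mul_of_pos_right hy hp0
      _ ≤ ‖(2 : ℚ_[p])‖ := by rw [one_mul]; exact hp2

/-! ### Units of `ℚ_p` -/

/-- **Fermat**: for `‖u‖_p = 1`, `u^{p-1}` is a principal unit, `‖1 - u^{p-1}‖_p < 1`
(from `ZpExtension.PadicUnits.norm_pow_sub_one_sub_one_lt` on `ℤ_pˣ`). [folklore] -/
theorem norm_one_sub_pow_sub_one_lt {u : ℚ_[p]} (hu : ‖u‖ = 1) : ‖1 - u ^ (p - 1)‖ < 1 := by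
  let U : ℤ_[p] := ⟨u, hu.le⟩
  have hU : IsUnit U := PadicInt.isUnit_iff.mpr (by rw [PadicInt.norm_def]; exact hu)
  have h := ZpExtension.PadicUnits.norm_pow_sub_one_sub_one_lt hU.unit
  rw [IsUnit.unit_spec, PadicInt.norm_def, PadicInt.coe_sub, PadicInt.coe_pow,
    PadicInt.coe_one] at h
  rwa [norm_sub_rev]

/-- The unit part `x · p^{-ord_p x}` of `x ≠ 0` has norm `1`. [folklore] -/
theorem norm_mul_zpow_neg_valuation {x : ℚ_[p]} (hx : x ≠ 0) :
    ‖x * (p : ℚ_[p]) ^ (-x.valuation)‖ = 1 := by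
  have hp0 : (0 : ℝ) < p := by exact_mod_cast (Fact.out : p.Prime).pos
  rw [norm_mul, Padic.norm_p_zpow, neg_neg, Padic.norm_eq_zpow_neg_valuation hx,
    ← zpow_add₀ hp0.ne', neg_add_cancel, zpow_zero]

/-- `ord_p x = n` if `‖x‖_p = p^{-n}`. [folklore] -/
theorem valuation_eq_of_norm_eq {x : ℚ_[p]} (hx : x ≠ 0) {n : ℤ} (h : ‖x‖ = (p : ℝ) ^ (-n)) :
    x.valuation = n := by
  have hp0 : (0 : ℝ) < p := by exact_mod_cast (Fact.out : p.Prime).pos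
  have hp1 : (p : ℝ) ≠ 1 := by exact_mod_cast (Fact.out : p.Prime).ne_one
  rw [Padic.norm_eq_zpow_neg_valuation hx] at h
  exact neg_injective (zpow_right_injective₀ hp0 hp1 h)

/-- `(p : ℚ_p) - 1 ≠ 0`. [folklore] -/
theorem natCast_prime_sub_one_ne_zero : (p : ℚ_[p]) - 1 ≠ 0 := by
  have hp : p.Prime := Fact.out
  have : ((p - 1 : ℕ) : ℚ_[p]) ≠ 0 := by exact_mod_cast Nat.sub_ne_zero_of_lt hp.one_lt
  rwa [Nat.cast_sub hp.one_le, Nat.cast_one] at this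

/-- Unfolding `log_p` off zero:
`log_p x = (p-1)⁻¹ · L((x p^{-ord x})^{p-1})`. [folklore] -/
theorem padicLog_of_ne_zero {x : ℚ_[p]} (hx : x ≠ 0) :
    padicLog p x = ((p : ℚ_[p]) - 1)⁻¹ *
      padicLogSeries p ((x * (p : ℚ_[p]) ^ (-x.valuation)) ^ (p - 1)) := by
  rw [padicLog, if_neg hx]

/-- On principal units the normalising exponent `p - 1` is undone by the functional equation:
`log_p y = L(y)` for `‖1 - y‖_p < 1`. [folklore] -/
theorem padicLog_eq_padicLogSeries {y : ℚ_[p]} (hy : ‖1 - y‖ < 1) :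
    padicLog p y = padicLogSeries p y := by
  have hp : p.Prime := Fact.out
  have hy1 : ‖y‖ = 1 := norm_eq_one_of_norm_one_sub_lt hy
  have hy0 : y ≠ 0 := norm_pos_iff.mp (by rw [hy1]; exact one_pos)
  have hv : y.valuation = 0 := valuation_eq_of_norm_eq hy0 (n := 0) (by simpa using hy1)
  rw [padicLog_of_ne_zero hy0, hv, neg_zero, zpow_zero, mul_one, padicLogSeries_pow hy,
    Nat.cast_sub hp.one_le, Nat.cast_one, ← mul_assoc,
    inv_mul_cancel₀ natCast_prime_sub_one_ne_zero, one_mul]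

/-! ### The four discharges -/

variable (p) in
/-- **Discharge of `Literature.NumberTheory.EllipticCurves.hasSum_padicLog`** (Iwasawa 1972,
§4.4, Lemma): on principal units `‖y - 1‖_p < 1` the Iwasawa logarithm is the sum of the
logarithmic series, `log_p y = -∑_{n ≥ 1} (1 - y)ⁿ/n`. [cite: Iwasawa1972PadicL, §4.4, Lemma] -/
theorem hasSum_padicLog_holds : hasSum_padicLog p := by
  intro y hy
  rw [norm_sub_rev] at hy
  rw [padicLog_eq_padicLogSeries hy]
  exact hasSum_padicLogSeries hy

variable (p) in
/-- **Discharge of `Literature.NumberTheory.EllipticCurves.padicLog_natCast_self`**: the Iwasawa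
normalisation `log_p p = 0` (the unit part of `p` is `1` and `L(1) = 0`).
[cite: Iwasawa1972PadicL, §4.4] -/
theorem padicLog_natCast_self_holds : padicLog_natCast_self p := by
  have hp0 : (p : ℚ_[p]) ≠ 0 := Nat.cast_ne_zero.mpr (Fact.out : p.Prime).ne_zero
  change padicLog p (p : ℚ_[p]) = 0
  rw [padicLog_of_ne_zero hp0, Padic.valuation_p, zpow_neg, zpow_one, mul_inv_cancel₀ hp0,
    one_pow, padicLogSeries_one, mul_zero]

variable (p) in
/-- **Discharge of `Literature.NumberTheory.EllipticCurves.padicLog_mul`**: `log_p (x y) =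
log_p x + log_p y` for `x, y ≠ 0` (valuations add, unit parts multiply, and the functional
equation `padicLogSeries_mul` on principal units). [cite: Iwasawa1972PadicL, §4.4] -/
theorem padicLog_mul_holds : padicLog_mul p := by
  intro x y hx hy
  have hp0 : (p : ℚ_[p]) ≠ 0 := Nat.cast_ne_zero.mpr (Fact.out : p.Prime).ne_zero
  have hux := norm_one_sub_pow_sub_one_lt (norm_mul_zpow_neg_valuation hx)
  have huy := norm_one_sub_pow_sub_one_lt (norm_mul_zpow_neg_valuation hy)
  rw [padicLog_of_ne_zero hx, padicLog_of_ne_zero hy, padicLog_of_ne_zero (mul_ne_zero hx hy),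
    Padic.valuation_mul hx hy, ← mul_add, ← padicLogSeries_mul hux huy, ← mul_pow, neg_add,
    zpow_add₀ hp0]
  congr 2
  ring

variable (p) in
/-- **Discharge of `Literature.NumberTheory.EllipticCurves.padicLog_eq_zero_iff`**: the kernel
of the Iwasawa logarithm on `ℚ_pˣ` is `p^ℤ · μ(ℚ_p)`, i.e. for `x ≠ 0`,
`log_p x = 0 ↔ ∃ n k, k > 0 ∧ (x p^{-n})^k = 1` (Iwasawa 1972, §4.4).
(→): with `u = x p^{-ord x}` and `y = u^{p-1}` (a principal unit), `L(y) = 0` gives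
`L(y²) = 2 L(y) = 0` with `‖1 - y²‖ < ‖2‖`, so `y² = 1` by injectivity near `1`, i.e.
`(x p^{-ord x})^{2(p-1)} = 1`.  (←): `(x p^{-n})^k = 1` forces `‖x p^{-n}‖ = 1`, `n = ord_p x`,
and then `k · L(y) = L(y^k) = L(1) = 0`. [cite: Iwasawa1972PadicL, §4.4] -/
theorem padicLog_eq_zero_iff_holds : padicLog_eq_zero_iff p := by
  intro x hx
  have hp : p.Prime := Fact.out
  have hu : ‖x * (p : ℚ_[p]) ^ (-x.valuation)‖ = 1 := norm_mul_zpow_neg_valuation hx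
  have hy : ‖1 - (x * (p : ℚ_[p]) ^ (-x.valuation)) ^ (p - 1)‖ < 1 :=
    norm_one_sub_pow_sub_one_lt hu
  rw [padicLog_of_ne_zero hx, mul_eq_zero,
    or_iff_right (inv_ne_zero natCast_prime_sub_one_ne_zero)]
  constructor
  · intro hL
    refine ⟨x.valuation, (p - 1) * 2, by have := hp.two_le; omega, ?_⟩
    have hsq : padicLogSeries p (((x * (p : ℚ_[p]) ^ (-x.valuation)) ^ (p - 1)) ^ 2) = 0 := by
      rw [padicLogSeries_pow hy 2, hL, mul_zero]
    rw [pow_mul]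
    exact eq_one_of_padicLogSeries_eq_zero (norm_one_sub_sq_lt hy) hsq
  · rintro ⟨n, k, hk, hw⟩
    -- `‖x p^{-n}‖ = 1`, hence `n = ord_p x`
    have hw1 : ‖x * (p : ℚ_[p]) ^ (-n)‖ = 1 := by
      have h := congrArg norm hw
      rw [norm_pow, norm_one] at h
      exact (pow_eq_one_iff_of_nonneg (norm_nonneg _) hk.ne').mp h
    have hvn : x.valuation = n := by
      apply valuation_eq_of_norm_eq hx
      rw [norm_mul, Padic.norm_p_zpow, neg_neg] at hw1
      rw [zpow_neg]
      exact eq_inv_of_mul_eq_one_left hw1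
    rw [← hvn] at hw
    -- `k · L(y) = L(y^k) = L(1) = 0`
    have hk0 : (k : ℚ_[p]) ≠ 0 := Nat.cast_ne_zero.mpr hk.ne'
    have h := padicLogSeries_pow hy k
    rw [← pow_mul, pow_mul', hw, one_pow, padicLogSeries_one, eq_comm, mul_eq_zero,
      or_iff_right hk0] at h
    exact h

end Literature.NumberTheory.EllipticCurves

end
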